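import Summits.Ventures.AbcSig.Sieve.Eisenstein

/-!
# Venture AbcSig — the Eisenstein (module M6) exclusion: NAMED HYPOTHESIS and kernel-checked discharge

HONEST FRAMING. Interface + glue file of a COMPUTATION cell (`pub-abcsig`). No Diophantine statement is proved here and
nothing is a claim on ABC or any summit. This file turns the cell's module M6 ("the surviving prime `𝔫 = (n, θ − r)` of
an orbit is Eisenstein: `f ≡ G_λ (mod 𝔫)` to the Sturm bound, hence `ρ̄_{f,𝔫}` is reducible and is not the mod-`n`
representation of a Frey curve") into (1) ONE named, CITED hypothesis on the abstract newform model and (2) a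
kernel-checked certificate, so that rows no longer need an opaque per-orbit `Excludes` hypothesis for M6 orbits.

* `Standing S κ` — the standing hypotheses of [BS04, Lemma 3.3] on a datum (exactly the hypotheses of
  `NewformModel.BS04Package`): positive coefficients, `C` squarefree, prime `n ≥ 7`, `n ∤ ABC`, `A, B` `n`-th-power
  free, a primitive solution with `ab ≠ ±1`, in Frey case `κ`.
* `NewformModel.EisPackage` — **CITED NAMED HYPOTHESIS** strengthening clause (2) of `BS04Package`: if `ρ^E_n` (for a
  standing datum) arises from the newform `f` of level `N`, then for the prime `ν ∣ n` in question — typed as a ring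
  homomorphism `ψ : Coeff f → k` to a field of characteristic `n` — (i) `ψ(c_ℓ) ∈ bs04Allowed ℓ` for all odd primes
  `ℓ ∤ nN` [BS04, (3.1) p. 31 + Lemma 4.2], AND (ii) `f` is NOT congruent under `ψ` to an Eisenstein series
  `G_λ = Σ_{t ∣ N, t > 1} λ_t (E₂(z) − t E₂(tz))` up to a Sturm bound `B` (`6B ≥ [SL₂(ℤ) : Γ₀(N)]`). Printed inputs for
  (ii): [Sturm 1987, Thm. 1] (two modular forms of weight `k` on `Γ₀(N)` with coefficients in `𝓞` congruent modulo a
  prime for all indices `≤ k[SL₂(ℤ):Γ₀(N)]/12` are congruent), whence `c_p(f) ≡ 1 + p (mod ν)` for every prime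
  `p ∤ N`, so by Chebotarev and Brauer–Nesbitt `ρ̄_{f,ν}^{ss} ≅ 1 ⊕ χ_n` is reducible — contradicting the absolute
  irreducibility of `ρ^E_n` for `n ≥ 7`, `ab ≠ ±1` [BS04, Cor. 3.1] (with the printed caveat at `n = 7` of
  Bennett–Vatsal–Yazdani 2004 carried as for `BS04Package`). The `q`-expansion coefficients of `f` enter through
  `coeffOfFac` (= `a_m(f)` for a normalised newform, [DS05, Prop. 5.8.5]) and those of `E₂(z) − tE₂(tz) ∈ M₂(Γ₀(N))`,
  `t ∣ N`, through `eisCoeff` [DS05, §4.6]. CITED, never proved here; rows take `(hE : M.EisPackage)`.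
* `NewformModel.Refines N o X` — COMPUTED hypothesis (same status as `DataComplete`): the extended data `X` (all primes
  `p ≤ B`, including `2` and `p ∣ N`) belong to the same orbit and the same generator `θ` as the sieve data `o`; backed
  by the same engine level file (and meaningful because `o` pins `θ` down: `θ = c_ℓ` is one of its entries).
* `NewformModel.ExcludesStd N o n` — the conclusion shape: no STANDING datum with exponent `n` has `ρ^E_n` arising from
  a newform matching `o`. (Weaker — i.e. easier to justify — than `Excludes N o fam`, which quantifies over all data of a
  family; the v2 row templates accept either.)
* `M6Cert`, `M6Cert.check` (Boolean, `decide`) and **THEOREM `NewformModel.excludesStd_of_m6`**: `EisPackage` +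
  `Refines` + a passing certificate ⇒ `ExcludesStd N o n`. The certificate has three kernel-checked parts: the
  Eisenstein congruence at `θ ↦ r` (`EisCert.check`, file `Sieve/Eisenstein.lean`); an identity
  `F = (X − r)·H + n·Q` in `ℤ[X]`; and an ordinary sieve certificate (`OrbitCert`, file `Sieve/Certificate.lean`) for the
  data `o` with `F` replaced by `H`, which kills every realisation `φ` with `φ(X) ≠ r` — so the prime `(n, θ − r)` is
  handled by (ii) and every other prime above `n` by (i).

References: [BS04] Bennett–Skinner, Canad. J. Math. 56 (2004), (3.1), Lemma 4.2, Cor. 3.1; J. Sturm, LNM 1240 (1987),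
Thm. 1; Diamond–Shurman, GTM 228, §4.6, Prop. 5.8.5; cell records: lead ruling R6 (PLAN §10 A5), `referee/refeis.py`.
-/

namespace Summit.Ventures.AbcSig

open Polynomial

/-! ## Standing hypotheses and the named hypothesis -/

/-- The standing hypotheses of [BS04, Lemma 3.3] on a datum `S` in Frey case `κ` — literally the hypotheses under which
`NewformModel.BS04Package` produces a newform. -/
def Standing (S : FreyDatum) (κ : FreyCase) : Prop :=
  0 < S.A ∧ 0 < S.B ∧ 0 < S.C ∧ Squarefree S.C ∧ S.n.Prime ∧ 7 ≤ S.n ∧ ¬ S.n ∣ S.A * S.B * S.C ∧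
    (∀ q : ℕ, q.Prime → ¬ q ^ S.n ∣ S.A ∧ ¬ q ^ S.n ∣ S.B) ∧
    IsPrimitiveSolution S.A S.B S.C S.n S.a S.b S.c ∧ S.a * S.b ≠ 1 ∧ S.a * S.b ≠ -1 ∧
    κ.Holds S.A S.B S.C S.n S.a S.b S.c

/-- **NAMED HYPOTHESIS (CITED) — [BS04, (3.1) + Lemma 4.2 + Cor. 3.1] with [Sturm 1987, Thm. 1].** For a standing
datum `S` (exponent `n`) and a newform `f` of level `N` from which `ρ^E_n` arises there is a ring homomorphism
`ψ : Coeff f → k` to a field of characteristic `n` (reduction modulo the prime `ν ∣ n` of [BS04, p. 31]) with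
(i) `ψ(c_ℓ(f)) ∈ bs04Allowed ℓ` for every odd prime `ℓ ≠ n`, `ℓ ∤ N`, and (ii) for every Eisenstein combination `λ`
and every `B` reaching the weight-2 Sturm bound of `Γ₀(N)`, `f` is NOT congruent to `G_λ` under `ψ` up to `q^B`
(else `ρ̄_{f,ν}` would be reducible, contradicting Cor. 3.1). See the module docstring for the printed inputs. -/
def NewformModel.EisPackage (M : NewformModel) : Prop :=
  ∀ (S : FreyDatum) (κ : FreyCase), Standing S κ →
    ∀ (N : ℕ) (f : M.Form N), M.Arises S N f →
      ∃ (k : Type) (_ : Field k) (_ : CharP k S.n) (ψ : M.Coeff N f →+* k),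
        (∀ ℓ : ℕ, ℓ.Prime → ℓ ≠ 2 → ℓ ≠ S.n → ¬ ℓ ∣ N → ∃ t ∈ bs04Allowed ℓ, ψ (M.eig N f ℓ) = (t : k)) ∧
        ∀ (lam : List (ℕ × ℤ)) (B : ℕ), SturmReaches N B → ¬ M.EisensteinCongruent f ψ lam B

/-- **COMPUTED HYPOTHESIS** `M.Refines N o X`: every newform carrying the sieve data `o` with generator `θ` also carries
the extended data `X` with the SAME `θ` (more Hecke eigenvalues of the same orbit in the same coordinates; backed by
the engine level file exactly like `DataComplete`). -/
def NewformModel.Refines (M : NewformModel) (N : ℕ) (o X : OrbitData) : Prop :=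
  ∀ (f : M.Form N) (θ : M.Coeff N f), evalL θ o.F = 0 →
    (∀ e ∈ o.coeffs, (e.d : M.Coeff N f) * M.eig N f e.ell = evalL θ e.g) →
    ∀ e ∈ X.coeffs, (e.d : M.Coeff N f) * M.eig N f e.ell = evalL θ e.g

/-- `M.ExcludesStd N o n`: for NO standing datum with exponent `n` does `ρ^E_n` arise from a newform of level `N`
matching the orbit data `o`. -/
def NewformModel.ExcludesStd (M : NewformModel) (N : ℕ) (o : OrbitData) (n : ℕ) : Prop :=
  ∀ (S : FreyDatum) (κ : FreyCase), Standing S κ → S.n = n → ∀ f : M.Form N, M.Matches f o → ¬ M.Arises S N f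

/-- A cited family exclusion implies the standing-datum exclusion for every exponent, provided the family contains all
standing data with that exponent that the row cares about — recorded here only in the trivially true direction used by
rows: `Excludes N o fam` with `fam ⊇ {standing data with exponent n}`. -/
theorem NewformModel.excludesStd_of_excludes (M : NewformModel) {N : ℕ} {o : OrbitData} {n : ℕ}
    (fam : FreyDatum → Prop) (hfam : ∀ S κ, Standing S κ → S.n = n → fam S) (h : M.Excludes N o fam) :
    M.ExcludesStd N o n :=
  fun S κ hS hn f hfo => h S (hfam S κ hS hn) f hfo

/-! ## Splitting off the root `r`: `F = (X − r)·H + n·Q` -/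

/-- Boolean check of the polynomial identity `F = (X − r)·H + n·Q` on coefficient lists. -/
def splitCheck (F H Q : List ℤ) (r : ℤ) (n : ℕ) : Bool :=
  isZeroL (addL (addL (mulL [-r, 1] H) (smulL (n : ℤ) Q)) (smulL (-1) F))

/-- If `F = (X − r)·H + n·Q` then every `φ : ℤ[X] → k` into a field of characteristic `n` with `φ(F) = 0` and
`φ(X) ≠ r` kills `H`. -/
theorem splitCheck_kills {F H Q : List ℤ} {r : ℤ} {n : ℕ} (h : splitCheck F H Q r n = true) {k : Type} [Field k]
    [CharP k n] (φ : ℤ[X] →+* k) (hF : φ (toPoly F) = 0) (hX : φ X ≠ (r : k)) : φ (toPoly H) = 0 := by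
  have h0 := toPoly_eq_zero_of_isZeroL _ h
  rw [toPoly_addL, toPoly_addL, toPoly_mulL, toPoly_smulL, toPoly_smulL] at h0
  have hn : φ (C (n : ℤ)) = 0 := by
    rw [map_natCast C n, map_natCast φ n]
    exact CharP.cast_eq_zero k n
  have hC : ∀ z : ℤ, φ (C z) = (z : k) := fun z =>
    (RingHom.comp_apply φ C z).symm.trans (eq_intCast (φ.comp C) z)
  have hlin : φ (toPoly [-r, 1]) = φ X - (r : k) := by
    simp only [toPoly_cons, toPoly_nil, map_add, map_mul, hC, mul_zero, add_zero, mul_one, Int.cast_neg,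
      Int.cast_one]
    ring
  have h1 := congrArg φ h0
  simp only [map_add, map_mul, map_zero, hF, hn, mul_zero, zero_mul, add_zero, hlin] at h1
  rcases mul_eq_zero.mp h1 with h3 | h3
  · exact absurd (sub_eq_zero.mp h3) hX
  · exact h3

/-! ## M6 certificates and the discharge theorem -/

/-- A module-M6 certificate for the orbit data `o` at the exponent `E.n`: extended data `X`, the Eisenstein certificate
`E` (prime `(E.n, θ − E.r)`), the cofactors of `F = (X − r)·H + n·Q`, and an ordinary sieve certificate `certH` for
`o` with `F` replaced by `H` (the realisations through the OTHER primes above `n`). -/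
structure M6Cert where
  /-- extended orbit data (entries at every prime `p ≤ B`) -/
  X : OrbitData
  /-- the Eisenstein-congruence certificate -/
  E : EisCert
  /-- `H` with `F = (X − r)·H + n·Q` -/
  H : List ℤ
  /-- `Q` with `F = (X − r)·H + n·Q` -/
  Q : List ℤ
  /-- sieve certificate for `{F := H, coeffs := o.coeffs}` -/
  certH : OrbitCert

/-- The orbit data with `F` replaced by the cofactor `H` (realisations avoiding `θ ↦ r`). -/
def M6Cert.oH (c : M6Cert) (o : OrbitData) : OrbitData := { F := c.H, coeffs := o.coeffs }

/-- **M6 check** (Boolean): Eisenstein congruence (`EisCert.check`), the splitting identity, the relative sieve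
certificate, and `n` not among its bases. -/
def M6Cert.check (c : M6Cert) (N : ℕ) (o : OrbitData) : Bool :=
  c.E.check N c.X && splitCheck o.F c.H c.Q c.E.r c.E.n && c.certH.check (c.oH o) bs04Allowed &&
    !((c.certH.fac.map Prod.fst).contains c.E.n)

/-- **Discharge of an M6 orbit.** `EisPackage` (CITED) + `Refines N o c.X` (COMPUTED) + a passing `M6Cert` (KERNEL) +
well-formed sieve entries ⇒ `M.ExcludesStd N o c.E.n`. Proof: for a standing `S` with `S.n = n` and `f` matching `o`
via `θ`, `EisPackage` yields `ψ`; if `ψ(θ) = r` the Eisenstein certificate contradicts (ii); otherwise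
`φ = ψ ∘ (X ↦ θ)` kills `H` (splitting identity, `ψ(θ) − r ≠ 0` in the field `k`) and realises the data
`{F := H, coeffs := o.coeffs}` with allowed traces by (i), which the relative sieve certificate forbids. -/
theorem NewformModel.excludesStd_of_m6 (M : NewformModel) (hE : M.EisPackage) {N : ℕ} (o : OrbitData) (c : M6Cert)
    (hwf : ∀ e ∈ o.coeffs, e.ell.Prime ∧ e.ell ≠ 2 ∧ ¬ e.ell ∣ N) (hRef : M.Refines N o c.X)
    (hc : c.check N o = true) : M.ExcludesStd N o c.E.n := by
  simp only [M6Cert.check, Bool.and_eq_true, Bool.not_eq_true'] at hc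
  obtain ⟨⟨⟨hEis, hsplit⟩, hcert⟩, hbase⟩ := hc
  have hbase' : c.E.n ∉ c.certH.fac.map Prod.fst := by
    intro hm
    have : (c.certH.fac.map Prod.fst).contains c.E.n = true := List.contains_iff_mem.mpr hm
    rw [this] at hbase
    exact Bool.noConfusion hbase
  intro S κ hS hn f hfo harises
  obtain ⟨hA, hB, hC, hsq, hprime, h7, hndvd, hfree, hsol, hab1, hab2, hcase⟩ := hS
  obtain ⟨θ, hF, hco⟩ := hfo
  obtain ⟨k, hk, hchar, ψ, hallowed, hnoteis⟩ := hE S κ ⟨hA, hB, hC, hsq, hprime, h7, hndvd, hfree, hsol, hab1, hab2, hcase⟩ N f harises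
  have hchar' : CharP k c.E.n := hn ▸ hchar
  by_cases hr : ψ θ = (c.E.r : k)
  · obtain ⟨hcong, hsturm⟩ := c.E.check_sound c.X hEis M f θ (hRef f θ hF hco) ψ hr
    exact hnoteis c.E.lam c.E.B hsturm hcong
  · let φ : ℤ[X] →+* k := ψ.comp (Polynomial.eval₂RingHom (Int.castRingHom (M.Coeff N f)) θ)
    have hφ : ∀ P : List ℤ, φ (toPoly P) = ψ (evalL θ P) := fun P => rfl
    have hφF : φ (toPoly o.F) = 0 := by rw [hφ, hF, map_zero]
    have hφX : φ X = ψ θ := by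
      show ψ (Polynomial.eval₂ (Int.castRingHom (M.Coeff N f)) θ X) = ψ θ
      rw [eval₂_X]
    have hH : φ (toPoly c.H) = 0 := splitCheck_kills hsplit φ hφF (by rwa [hφX])
    have helim : (c.oH o).Eliminated bs04Allowed c.E.n :=
      c.certH.check_sound (c.oH o) bs04Allowed hcert c.E.n (hn ▸ hprime) hbase'
    refine helim k φ ⟨hH, ?_⟩
    intro e he hne
    obtain ⟨hp, h2, hNe⟩ := hwf e he
    obtain ⟨t, ht, hψt⟩ := hallowed e.ell hp h2 (by rw [hn]; exact hne) hNe
    refine ⟨t, ht, ?_⟩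
    show φ (toPoly e.g) = _
    rw [hφ, ← hco e he, map_mul, hψt, map_intCast]

end Summit.Ventures.AbcSig
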